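import Summits.NavierStokesRegularity.FunctionalMining.NoGo.StretchingSupExplicit
import Literature.Analysis.FunctionSpaces.TorusSecondRieszSharp
import HarnessLib

/-!
# Functional mining (K1-Q1/U-explicit, bridge): the explicit constant below Hölder, conditional on the NAMED Literature fact of Bañuelos–Méndez-Hernández / Bañuelos–Bogdan

Search for candidate a priori estimates; no regularity claim.

Cell `pub-nsfunc`, dict seat (gen 11), STAGED for the prove seat (target tree path
`Summits/NavierStokesRegularity/FunctionalMining/NoGo/StretchingSupExplicitBMH.lean`; file AFTER
`NoGo/StretchingSupExplicit.lean`). Typed question K1-Q1/U-explicit (`HOME/DICTIONARY.md` §14 row D2a;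
`HOME/pub-nsfunc-dict/K1Q1-LADDER.md` §B).

CONTEXT. `NoGo/StretchingSupExplicit.lean` proves, on `𝕋³`,
`HessianL4Bound 3 → StretchingSupBound (2/√3 − 1/(4√3·11337409))` and
`HessianL4Bound 3 → stretchingSupConst ≤ 2/√3 − 1/(4√3·11337409)`, where the hypothesis
`HessianL4Bound 3` (`‖∂ⱼ∂ₖw‖_{L⁴(𝕋³)} ≤ 3‖Δw‖_{L⁴(𝕋³)}` for smooth `w`) was left undischarged. The literature
seat has since typed the published sharp-constant second-order Riesz bound as the NAMED FACT
`Literature.Analysis.FunctionSpaces.Torus.secondRiesz_hessian_le_laplacian_sharp` — a `def … : Prop` with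
citation tags (Bañuelos–Méndez-Hernández, Indiana Univ. Math. J. 52 (2003), Thm. 1; Bañuelos–Bogdan,
J. Funct. Anal. 250 (2007), eqs. (4), (5), (34); torus transference Geiss–Montgomery-Smith–Saksman, Trans.
AMS 362 (2010), Lemma 2.2 / Grafakos (2014), Thm. 4.3.7, Prop. 5.1.17), NOTHING ASSERTED and no kernel
proof — together with the PROVED specialisation `secondRiesz_hessian_le_laplacian_sharp.four`
(`p = 4`, constant `p* − 1 = 3`). At `d = Fin 3` that specialisation is literally `HessianL4Bound 3`.

THEOREMS (this file is only the bridge; every conclusion is CONDITIONAL on the named fact, displayed as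
the hypothesis `h`, exactly as the tree displays `StrainL4Bound K`):
* `hessianL4Bound_three : secondRiesz_hessian_le_laplacian_sharp (d := Fin 3) → HessianL4Bound 3`;
* `strainL4Bound_of_sharpRiesz : … → StrainL4Bound 2834352`;
* `stretchingSupBound_of_sharpRiesz : … → StretchingSupBound (2/√3 − 1/(4√3·11337409))`;
* `stretchingSupConst_le_of_sharpRiesz : … → stretchingSupConst ≤ 2/√3 − 1/(4√3·11337409)`.

HONEST SIZE. Modulo one cited published theorem (Literature debt, named not vendored) the tree now holds
an EXPLICIT number `2/√3 − 1.27·10⁻⁸` above `C⋆`; this is bookkeeping, not an approach to the VALUE of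
`C⋆ ∈ [(2+√5)/8, 2/√3)`: the whole `L⁴` Calderón–Zygmund door is floored at `2/√3 − 1/(328√3) ≈ 1.15294`
(`NoGo/StretchingStrainL4Floor.lean`, modulo the companion named fact of Geiss–Montgomery-Smith–Saksman).
Nothing here is a statement about Navier–Stokes solutions.
-/

noncomputable section

open MeasureTheory Set
open scoped ENNReal NNReal

namespace Summit.NavierStokesRegularity.FunctionalMining

open Literature.Analysis.FunctionSpaces Literature.Analysis.FunctionSpaces.Torus

/-- **The bridge**: the named Literature fact (sharp second-order Riesz constant `p* − 1`, here at
`p = 4`, `d = Fin 3`) gives `HessianL4Bound 3` — by `secondRiesz_hessian_le_laplacian_sharp.four`, whose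
statement at `d = Fin 3` is the body of `HessianL4Bound 3`. Search for candidate a priori estimates; no
regularity claim. [ours — K1-Q1/U-explicit; the input is the cited `Prop`, displayed as `h`] -/
theorem hessianL4Bound_three (h : secondRiesz_hessian_le_laplacian_sharp (d := Fin 3)) :
    HessianL4Bound 3 :=
  fun w hw j k => h.four w hw j k

/-- `∫|S|_F⁴ ≤ 2834352 ∫|ω|⁴` on smooth divergence-free fields of `𝕋³`, conditional on the named fact.
Search for candidate a priori estimates; no regularity claim. [ours] -/
theorem strainL4Bound_of_sharpRiesz (h : secondRiesz_hessian_le_laplacian_sharp (d := Fin 3)) :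
    StrainL4Bound (d := Fin 3) 2834352 :=
  strainL4Bound_explicit (hessianL4Bound_three h)

/-- **`σ ≤ (2/√3 − 1/(4√3·11337409))·‖ω‖_∞·ℰ` on `𝕋³`, conditional on the named fact** (margin
`≈ 1.27·10⁻⁸` below Hölder's `2/√3`). Search for candidate a priori estimates; no regularity claim. [ours] -/
theorem stretchingSupBound_of_sharpRiesz (h : secondRiesz_hessian_le_laplacian_sharp (d := Fin 3)) :
    StretchingSupBound (d := Fin 3) (2 / Real.sqrt 3 - 1 / (4 * Real.sqrt 3 * 11337409)) :=
  stretchingSupBound_explicit (hessianL4Bound_three h)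

/-- **`C⋆ ≤ 2/√3 − 1/(4√3·11337409)`, conditional on the named fact.** Search for candidate a priori
estimates; no regularity claim. [ours] -/
theorem stretchingSupConst_le_of_sharpRiesz (h : secondRiesz_hessian_le_laplacian_sharp (d := Fin 3)) :
    stretchingSupConst (d := Fin 3) ≤ 2 / Real.sqrt 3 - 1 / (4 * Real.sqrt 3 * 11337409) :=
  stretchingSupConst_le_explicit (hessianL4Bound_three h)

end Summit.NavierStokesRegularity.FunctionalMining

end
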